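import Summits.QuantumFields.YangMills.Theorems.FluctuationComparisonRegPrIntLS2BetaCriticalOrbitUnique
import HarnessLib

/-!
# S2β · seam (b) — (T7d) THE BRIDGE «CENTRAL STABILISER ⇒ SCALAR COMMUTANT (IRR(V))» for an `SU(2)` datum: the two irreducibility tokens of the (T)-chain AGREE

Cell `ym3-torus` (YM ladder rung R3 = continuum `SU(2)` Yang–Mills on the three-torus at fixed lattice data — a RUNG: NOT d = 4, NOT infinite volume,
NOT a mass gap, NOT Clay).  Width seat `ym3-torus-px21` (gen 19), the (T)-chain of LINE g18-1 S2β.  Crux `stmt-QuantumFields-20520`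
(`…Theses.UnitScaleTilt.FluctuationComparisonRegPrIntL`); `--kind proof --supports stmt-QuantumFields-20520 --as helper`, count-neutral, DEFINITION-FREE
(0 `def`, 0 `instance`, 0 `notation`, 0 `sorry`, default heartbeats).

WHY.  The per-datum chain at a generic datum carries two tokens for «`V` is irreducible»: the GROUP-level one of ✓px17 pen 4
`…S2BetaCriticalOrbitUnique.atMostOneCriticalOrbit_of_centralStab_five` — `∀ s : GaugeTransf (F.P J) 0 SU(2), GaugeField.gaugeAct s V = V → s = (fun _ => 1) ∨ s = (fun _ => ⟨-1, neg_one_mem⟩)`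
(every `SU(2)`-valued symmetry of `V` is `±1`; it runs Prop. 7 cl.1 and ✓px8 `…S2BetaIsolOfCriticalOrbitUnique`) — and the LINEAR one of (T7a)∕(T7b) `…S2BetaNearSymmetryRigidity` ∕
`…S2BetaPosCollarAtIrreducible` — IRR(V): `∀ s : Site (F.P J) 0 → M₂(ℂ), (∀ b, s b.src * ↑(V b) = ↑(V b) * s b.tgt) → ∃ c : ℂ, ∀ x, s x = c • 1` (the commutant is scalar; it runs
near-symmetry rigidity and POS∘∕TUBE♭).  IRR ⇒ central-stabiliser is immediate (px17 pen 6 `…S2BetaCentralStabOfIrr`).  THIS FILE proves the converse, so the tokens are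
EQUIVALENT by kernel and every consumer may key on either:
* §1 (2×2 algebra) `hermTraceless_mul_self` (`H·H = (|H₀₀|² + |H₀₁|²)·1` for Hermitian traceless `H`), `hermTraceless_det` (`det H = −(|H₀₀|² + |H₀₁|²)`), `hermTraceless_eq_zero`,
  ★ `smul_mem_specialUnitaryGroup_of_hermTraceless` (`(i∕√ρ)·H ∈ SU(2)`, `ρ = |H₀₀|² + |H₀₁|² > 0` — the unit imaginary quaternion of `H`).
* §2 `eq_conj_of_comm` ∕ `comm_conjTranspose` (the commutant relation transports by conjugation along a bond and is closed under `ᴴ`),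
  ★★ `hermTraceless_comm_eq_zero` — a Hermitian traceless commutant element of a central-stabiliser datum VANISHES: `x ↦ (i∕√ρ_x)·T x` (`1` where `T x = 0`) is an
  `SU(2)`-valued symmetry (`ρ_x = −det T x` is constant ALONG EACH BOND, which is all the bondwise check needs), with a traceless value wherever `T x ≠ 0` — not `±1`;
  ★★★ `irr_of_centralStab` — THE BRIDGE: split `s x = ½tr(s x)·1 + Y x` (the trace is a conjugation invariant, constant along bonds); `Y + Yᴴ` and `i·(Y − Yᴴ)` are Hermitian
  traceless commutant elements, hence `0`; so `s x = α_x·1` with `α` constant along bonds, and the `±1`-valued test symmetry `x ↦ [α_x = α_{x₀}]` is a stabiliser, hence `≡ 1`: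
  `α` is GLOBALLY constant.  NO lattice-connectivity argument is needed — the central-stabiliser hypothesis supplies it (a disconnected lattice has non-central `±1`-valued
  stabilisers).
CONSUMERS: (T7b) `growthOn_nhds_at_isCritR2_of_irr_five` ∕ `posCollar_at_isCritR2_of_irr_five` ∕ `tubeGrowth_at_isCritR2_of_irr_of_isolated_five` at pen 4's token via `irr_of_centralStab`.

HONEST: finite-dimensional *-algebra bookkeeping; nothing of Bałaban's analysis; the REDUCIBLE stratum (non-central stabiliser), (Lπ)_loc, ISOL∘(δ), `hreg`, TUBE-REG∘ (datum-free δ,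
K-uniform μ), GAP♯∘, GAP♭, EXW∘, S2β, crux 20520 NOT proved; no summit statement is proved by a helper; finite-volume ∕ conditional; rung R3 = SU(2) YM₃ on T³ — NOT d = 4,
NOT infinite volume, NOT a mass gap, NOT Clay; the Yang–Mills mass gap is NOT proved.  Sorry-free, axioms standard.

References: T. Bałaban, CMP **102** (1985) 277–309 [Balaban1985Variational] ((4) p.278, Prop. 7 p.299); CMP **98** (1985) 17–51 [Balaban1985Averaging] ((8) p.19, (11)–(13) p.19).
-/

set_option autoImplicit false

noncomputable section

namespace Summit.QuantumFields.YangMills.Theorems.FluctuationComparisonRegPrIntLS2BetaIrrOfCentralStab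

open scoped Matrix ComplexConjugate
open Literature.MathematicalPhysics.QuantumFieldTheory.Balaban1983to89
open Literature.MathematicalPhysics.QuantumFieldTheory.Balaban1983to89.T3ContinuumYM3Torus
open Summit.QuantumFields.YangMills.Theorems.BrascampLiebVacuumSC.DimensionGapSU2 (neg_one_mem)

/-! ## §1 Hermitian traceless `2×2` matrices: `H² = ρ·1`, `det H = −ρ`, `ρ = |H₀₀|² + |H₀₁|²`, and the `SU(2)` element `(i∕√ρ)·H` -/

section TwoByTwo

/-- For a Hermitian traceless `H ∈ M₂(ℂ)`: `H·H = (|H₀₀|² + |H₀₁|²)·1`. [folklore] -/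
theorem hermTraceless_mul_self (H : Matrix (Fin 2) (Fin 2) ℂ) (hH : H.IsHermitian) (htr : H.trace = 0) :
    H * H = ((Complex.normSq (H 0 0) + Complex.normSq (H 0 1) : ℝ) : ℂ) • (1 : Matrix (Fin 2) (Fin 2) ℂ) := by
  have h00 : conj (H 0 0) = H 0 0 := hH.apply 0 0
  have h10 : H 1 0 = conj (H 0 1) := (hH.apply 1 0).symm
  have h11 : H 1 1 = -H 0 0 := by
    rw [Matrix.trace_fin_two] at htr
    exact eq_neg_of_add_eq_zero_right htr
  have hsq0 : H 0 0 * H 0 0 = (Complex.normSq (H 0 0) : ℂ) := by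
    nth_rewrite 2 [← h00]
    exact Complex.mul_conj _
  have hsq1 : H 0 1 * conj (H 0 1) = (Complex.normSq (H 0 1) : ℂ) := Complex.mul_conj _
  ext i j
  fin_cases i <;> fin_cases j
  · simp only [Matrix.mul_apply, Fin.sum_univ_two, Matrix.smul_apply, Matrix.one_apply_eq, smul_eq_mul, mul_one, Fin.zero_eta,
      Fin.isValue]
    rw [h10, hsq0, hsq1, Complex.ofReal_add]
  · simp only [Matrix.mul_apply, Fin.sum_univ_two, Matrix.smul_apply, Fin.zero_eta, Fin.isValue, Fin.mk_one, ne_eq, zero_ne_one,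
      not_false_eq_true, Matrix.one_apply_ne, smul_zero]
    rw [h11]; ring
  · simp only [Matrix.mul_apply, Fin.sum_univ_two, Matrix.smul_apply, Fin.zero_eta, Fin.isValue, Fin.mk_one, ne_eq, one_ne_zero,
      not_false_eq_true, Matrix.one_apply_ne, smul_zero]
    rw [h11]; ring
  · simp only [Matrix.mul_apply, Fin.sum_univ_two, Matrix.smul_apply, Matrix.one_apply_eq, smul_eq_mul, mul_one, Fin.mk_one,
      Fin.isValue]
    rw [h10, h11, mul_comm (conj (H 0 1)), hsq1, neg_mul_neg, hsq0, Complex.ofReal_add, add_comm]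

/-- For a Hermitian traceless `H ∈ M₂(ℂ)`: `det H = −(|H₀₀|² + |H₀₁|²)`. [folklore] -/
theorem hermTraceless_det (H : Matrix (Fin 2) (Fin 2) ℂ) (hH : H.IsHermitian) (htr : H.trace = 0) :
    H.det = -((Complex.normSq (H 0 0) + Complex.normSq (H 0 1) : ℝ) : ℂ) := by
  have h00 : conj (H 0 0) = H 0 0 := hH.apply 0 0
  have h10 : H 1 0 = conj (H 0 1) := (hH.apply 1 0).symm
  have h11 : H 1 1 = -H 0 0 := by
    rw [Matrix.trace_fin_two] at htr
    exact eq_neg_of_add_eq_zero_right htr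
  have hsq0 : H 0 0 * H 0 0 = (Complex.normSq (H 0 0) : ℂ) := by
    nth_rewrite 2 [← h00]
    exact Complex.mul_conj _
  have hsq1 : H 0 1 * conj (H 0 1) = (Complex.normSq (H 0 1) : ℂ) := Complex.mul_conj _
  rw [Matrix.det_fin_two, h11, h10, mul_neg, hsq0, hsq1, Complex.ofReal_add]
  ring

/-- A Hermitian traceless `H ∈ M₂(ℂ)` with `|H₀₀|² + |H₀₁|² = 0` vanishes. [folklore] -/
theorem hermTraceless_eq_zero (H : Matrix (Fin 2) (Fin 2) ℂ) (hH : H.IsHermitian) (htr : H.trace = 0)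
    (h0 : Complex.normSq (H 0 0) + Complex.normSq (H 0 1) = 0) : H = 0 := by
  have h10 : H 1 0 = conj (H 0 1) := (hH.apply 1 0).symm
  have h11 : H 1 1 = -H 0 0 := by
    rw [Matrix.trace_fin_two] at htr
    exact eq_neg_of_add_eq_zero_right htr
  have ha : Complex.normSq (H 0 0) = 0 := by
    have := Complex.normSq_nonneg (H 0 1); have := Complex.normSq_nonneg (H 0 0); linarith
  have hb : Complex.normSq (H 0 1) = 0 := by
    have := Complex.normSq_nonneg (H 0 1); have := Complex.normSq_nonneg (H 0 0); linarith
  rw [Complex.normSq_eq_zero] at ha hb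
  ext i j
  fin_cases i <;> fin_cases j
  · simpa using ha
  · simpa using hb
  · simp [h10, hb]
  · simp [h11, ha]

/-- **THE `SU(2)` ELEMENT OF A NONZERO HERMITIAN TRACELESS `2×2` MATRIX**: `(i∕√ρ)·H ∈ SU(2)` for `ρ = |H₀₀|² + |H₀₁|² > 0` (a unit imaginary quaternion). [folklore] -/
theorem smul_mem_specialUnitaryGroup_of_hermTraceless (H : Matrix (Fin 2) (Fin 2) ℂ) (hH : H.IsHermitian) (htr : H.trace = 0)
    (hρ : 0 < Complex.normSq (H 0 0) + Complex.normSq (H 0 1)) :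
    (Complex.I * ((Real.sqrt (Complex.normSq (H 0 0) + Complex.normSq (H 0 1)) : ℂ))⁻¹) • H ∈ Matrix.specialUnitaryGroup (Fin 2) ℂ := by
  set ρ : ℝ := Complex.normSq (H 0 0) + Complex.normSq (H 0 1) with hρdef
  have hsqrt : (Real.sqrt ρ : ℂ) ≠ 0 := by
    rw [Ne, Complex.ofReal_eq_zero]; exact (Real.sqrt_pos.mpr hρ).ne'
  have hsq : ((Real.sqrt ρ : ℂ)) * (Real.sqrt ρ : ℂ) = (ρ : ℂ) := by
    rw [← Complex.ofReal_mul, Real.mul_self_sqrt hρ.le]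
  have hρ0 : (ρ : ℂ) ≠ 0 := by rw [Ne, Complex.ofReal_eq_zero]; exact hρ.ne'
  rw [Matrix.mem_specialUnitaryGroup_iff]
  constructor
  · have hc : (Complex.I * ((Real.sqrt ρ : ℂ))⁻¹) * star (Complex.I * ((Real.sqrt ρ : ℂ))⁻¹) = ((ρ⁻¹ : ℝ) : ℂ) := by
      rw [Complex.star_def, Complex.mul_conj, Complex.normSq_mul, Complex.normSq_inv, Complex.normSq_I, Complex.normSq_ofReal,
        Real.mul_self_sqrt hρ.le, one_mul]
    rw [Matrix.mem_unitaryGroup_iff, Matrix.star_eq_conjTranspose, Matrix.conjTranspose_smul, hH.eq, Matrix.smul_mul, Matrix.mul_smul,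
      hermTraceless_mul_self H hH htr, smul_smul, smul_smul, ← hρdef, hc, ← Complex.ofReal_mul, inv_mul_cancel₀ hρ.ne',
      Complex.ofReal_one, one_smul]
  · rw [Matrix.det_smul, hermTraceless_det H hH htr, Fintype.card_fin, ← hρdef, mul_pow, Complex.I_sq, inv_pow, sq, hsq]
    field_simp

end TwoByTwo

/-! ## §2 The bridge: central stabiliser ⟹ scalar commutant -/

section Bridge

variable (F : T3Family) {J : ℕ}

/-- The commutant relation transports along a bond by conjugation: `s(b₋)·V_b = V_b·s(b₊)` ⟹ `s(b₊) = V_b⁻¹·s(b₋)·V_b`. [folklore] -/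
theorem eq_conj_of_comm (V : GaugeField (F.P J) 0 (Matrix.specialUnitaryGroup (Fin 2) ℂ)) (s : Site (F.P J) 0 → Matrix (Fin 2) (Fin 2) ℂ) (b : PBond (F.P J) 0)
    (h : s b.src * (V b : Matrix (Fin 2) (Fin 2) ℂ) = (V b : Matrix (Fin 2) (Fin 2) ℂ) * s b.tgt) :
    s b.tgt = star (V b : Matrix (Fin 2) (Fin 2) ℂ) * s b.src * (V b : Matrix (Fin 2) (Fin 2) ℂ) := by
  have hV : star (V b : Matrix (Fin 2) (Fin 2) ℂ) * (V b : Matrix (Fin 2) (Fin 2) ℂ) = 1 := Matrix.mem_unitaryGroup_iff'.1 (V b).2.1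
  calc s b.tgt = (star (V b : Matrix (Fin 2) (Fin 2) ℂ) * (V b : Matrix (Fin 2) (Fin 2) ℂ)) * s b.tgt := by rw [hV, one_mul]
    _ = star (V b : Matrix (Fin 2) (Fin 2) ℂ) * ((V b : Matrix (Fin 2) (Fin 2) ℂ) * s b.tgt) := by rw [mul_assoc]
    _ = star (V b : Matrix (Fin 2) (Fin 2) ℂ) * (s b.src * (V b : Matrix (Fin 2) (Fin 2) ℂ)) := by rw [h]
    _ = star (V b : Matrix (Fin 2) (Fin 2) ℂ) * s b.src * (V b : Matrix (Fin 2) (Fin 2) ℂ) := by rw [mul_assoc]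

/-- The commutant is closed under the sitewise conjugate transpose. [folklore] -/
theorem comm_conjTranspose (V : GaugeField (F.P J) 0 (Matrix.specialUnitaryGroup (Fin 2) ℂ)) (s : Site (F.P J) 0 → Matrix (Fin 2) (Fin 2) ℂ)
    (h : ∀ b : PBond (F.P J) 0, s b.src * (V b : Matrix (Fin 2) (Fin 2) ℂ) = (V b : Matrix (Fin 2) (Fin 2) ℂ) * s b.tgt) (b : PBond (F.P J) 0) :
    (s b.src)ᴴ * (V b : Matrix (Fin 2) (Fin 2) ℂ) = (V b : Matrix (Fin 2) (Fin 2) ℂ) * (s b.tgt)ᴴ := by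
  have hV : star (V b : Matrix (Fin 2) (Fin 2) ℂ) * (V b : Matrix (Fin 2) (Fin 2) ℂ) = 1 := Matrix.mem_unitaryGroup_iff'.1 (V b).2.1
  have hV' : (V b : Matrix (Fin 2) (Fin 2) ℂ) * star (V b : Matrix (Fin 2) (Fin 2) ℂ) = 1 := Matrix.mem_unitaryGroup_iff.1 (V b).2.1
  -- conjugate-transpose `s(b₋) V = V s(b₊)`: `Vᴴ s(b₋)ᴴ = s(b₊)ᴴ Vᴴ`, then move `V` across
  have h1 : star (V b : Matrix (Fin 2) (Fin 2) ℂ) * (s b.src)ᴴ = (s b.tgt)ᴴ * star (V b : Matrix (Fin 2) (Fin 2) ℂ) := by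
    have := congrArg Matrix.conjTranspose (h b)
    simpa only [Matrix.conjTranspose_mul, Matrix.star_eq_conjTranspose] using this
  calc (s b.src)ᴴ * (V b : Matrix (Fin 2) (Fin 2) ℂ) = (V b : Matrix (Fin 2) (Fin 2) ℂ) * (star (V b : Matrix (Fin 2) (Fin 2) ℂ) * (s b.src)ᴴ) * (V b : Matrix (Fin 2) (Fin 2) ℂ) := by
        rw [← mul_assoc, hV', one_mul]
    _ = (V b : Matrix (Fin 2) (Fin 2) ℂ) * ((s b.tgt)ᴴ * star (V b : Matrix (Fin 2) (Fin 2) ℂ)) * (V b : Matrix (Fin 2) (Fin 2) ℂ) := by rw [h1]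
    _ = (V b : Matrix (Fin 2) (Fin 2) ℂ) * (s b.tgt)ᴴ * (star (V b : Matrix (Fin 2) (Fin 2) ℂ) * (V b : Matrix (Fin 2) (Fin 2) ℂ)) := by simp only [mul_assoc]
    _ = (V b : Matrix (Fin 2) (Fin 2) ℂ) * (s b.tgt)ᴴ := by rw [hV, mul_one]

/-- **A HERMITIAN TRACELESS ELEMENT OF THE COMMUTANT OF A CENTRAL-STABILISER DATUM VANISHES.**  If every `SU(2)`-valued symmetry of `V` is `±1` (px17 pen 4's token) and
`T : sites → M₂(ℂ)` is in the commutant with each `T x` Hermitian and traceless, then `T = 0`: otherwise `x ↦ (i∕√ρ)·T x` (`1` where `T x = 0`) is an `SU(2)`-valued symmetry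
of `V` with a traceless value somewhere, not `±1`. [cite: Balaban1985Variational, (4) p.278, Prop. 7 p.299] -/
theorem hermTraceless_comm_eq_zero (V : GaugeField (F.P J) 0 (Matrix.specialUnitaryGroup (Fin 2) ℂ))
    (hstab : ∀ s : GaugeTransf (F.P J) 0 (Matrix.specialUnitaryGroup (Fin 2) ℂ), GaugeField.gaugeAct s V = V →
      s = (fun _ => 1) ∨ s = (fun _ => (⟨-1, neg_one_mem⟩ : Matrix.specialUnitaryGroup (Fin 2) ℂ)))
    (T : Site (F.P J) 0 → Matrix (Fin 2) (Fin 2) ℂ) (hcomm : ∀ b : PBond (F.P J) 0, T b.src * (V b : Matrix (Fin 2) (Fin 2) ℂ) = (V b : Matrix (Fin 2) (Fin 2) ℂ) * T b.tgt)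
    (hH : ∀ x, (T x).IsHermitian) (htr : ∀ x, (T x).trace = 0) : T = 0 := by
  classical
  -- `ρ x := |T x 0 0|² + |T x 0 1|²` is constant along bonds (it is `−det (T x)`, a conjugation invariant)
  have hρeq : ∀ b : PBond (F.P J) 0, Complex.normSq (T b.tgt 0 0) + Complex.normSq (T b.tgt 0 1) = Complex.normSq (T b.src 0 0) + Complex.normSq (T b.src 0 1) := by
    intro b
    have hdet : (T b.tgt).det = (T b.src).det := by
      rw [eq_conj_of_comm F V T b (hcomm b), Matrix.det_mul, Matrix.det_mul, Matrix.star_eq_conjTranspose, Matrix.det_conjTranspose]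
      have hd : star (V b : Matrix (Fin 2) (Fin 2) ℂ).det * (V b : Matrix (Fin 2) (Fin 2) ℂ).det = 1 := by
        rw [← Matrix.det_conjTranspose, ← Matrix.det_mul, ← Matrix.star_eq_conjTranspose, Matrix.mem_unitaryGroup_iff'.1 (V b).2.1, Matrix.det_one]
      calc star (V b : Matrix (Fin 2) (Fin 2) ℂ).det * (T b.src).det * (V b : Matrix (Fin 2) (Fin 2) ℂ).det = (star (V b : Matrix (Fin 2) (Fin 2) ℂ).det * (V b : Matrix (Fin 2) (Fin 2) ℂ).det) * (T b.src).det := by ring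
        _ = (T b.src).det := by rw [hd, one_mul]
    have h1 := hermTraceless_det (T b.tgt) (hH _) (htr _)
    have h2 := hermTraceless_det (T b.src) (hH _) (htr _)
    rw [hdet] at h1
    have h3 : ((Complex.normSq (T b.tgt 0 0) + Complex.normSq (T b.tgt 0 1) : ℝ) : ℂ) = ((Complex.normSq (T b.src 0 0) + Complex.normSq (T b.src 0 1) : ℝ) : ℂ) :=
      neg_injective (h1.symm.trans h2)
    exact_mod_cast h3
  -- the candidate symmetry
  obtain ⟨g, hg⟩ : ∃ g : Site (F.P J) 0 → Matrix.specialUnitaryGroup (Fin 2) ℂ, g = fun x =>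
      if hx : 0 < Complex.normSq (T x 0 0) + Complex.normSq (T x 0 1) then
        ⟨(Complex.I * ((Real.sqrt (Complex.normSq (T x 0 0) + Complex.normSq (T x 0 1)) : ℂ))⁻¹) • T x,
          smul_mem_specialUnitaryGroup_of_hermTraceless (T x) (hH x) (htr x) hx⟩
      else 1 := ⟨_, rfl⟩
  have hgval : ∀ x, 0 < Complex.normSq (T x 0 0) + Complex.normSq (T x 0 1) →
      ((g x : Matrix.specialUnitaryGroup (Fin 2) ℂ) : Matrix (Fin 2) (Fin 2) ℂ) = (Complex.I * ((Real.sqrt (Complex.normSq (T x 0 0) + Complex.normSq (T x 0 1)) : ℂ))⁻¹) • T x := by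
    intro x hx; rw [hg]; simp only [dif_pos hx]
  have hgone : ∀ x, ¬ 0 < Complex.normSq (T x 0 0) + Complex.normSq (T x 0 1) → g x = 1 := by
    intro x hx; rw [hg]; simp only [dif_neg hx]
  have hTzero : ∀ x, ¬ 0 < Complex.normSq (T x 0 0) + Complex.normSq (T x 0 1) → T x = 0 := by
    intro x hx
    have h0 : Complex.normSq (T x 0 0) + Complex.normSq (T x 0 1) = 0 :=
      le_antisymm (not_lt.mp hx) (add_nonneg (Complex.normSq_nonneg _) (Complex.normSq_nonneg _))
    exact hermTraceless_eq_zero (T x) (hH x) (htr x) h0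
  -- it stabilises `V`: bondwise `g(b₋)·V_b = V_b·g(b₊)` at the matrix level
  have hgcomm : ∀ b : PBond (F.P J) 0, ((g b.src : Matrix.specialUnitaryGroup (Fin 2) ℂ) : Matrix (Fin 2) (Fin 2) ℂ) * (V b : Matrix (Fin 2) (Fin 2) ℂ) = (V b : Matrix (Fin 2) (Fin 2) ℂ) * ((g b.tgt : Matrix.specialUnitaryGroup (Fin 2) ℂ) : Matrix (Fin 2) (Fin 2) ℂ) := by
    intro b
    by_cases hx : 0 < Complex.normSq (T b.src 0 0) + Complex.normSq (T b.src 0 1)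
    · have hy : 0 < Complex.normSq (T b.tgt 0 0) + Complex.normSq (T b.tgt 0 1) := by rw [hρeq b]; exact hx
      rw [hgval _ hx, hgval _ hy, hρeq b, Matrix.smul_mul, Matrix.mul_smul, hcomm b]
    · have hy : ¬ 0 < Complex.normSq (T b.tgt 0 0) + Complex.normSq (T b.tgt 0 1) := by rw [hρeq b]; exact hx
      rw [hgone _ hx, hgone _ hy, OneMemClass.coe_one, one_mul, mul_one]
  have hgstab : GaugeField.gaugeAct g V = V := by
    funext b
    apply Subtype.ext
    show ((g b.src * V b * (g b.tgt)⁻¹ : Matrix.specialUnitaryGroup (Fin 2) ℂ) : Matrix (Fin 2) (Fin 2) ℂ) = (V b : Matrix (Fin 2) (Fin 2) ℂ)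
    have hinv : ((g b.tgt : Matrix.specialUnitaryGroup (Fin 2) ℂ) : Matrix (Fin 2) (Fin 2) ℂ) * (((g b.tgt)⁻¹ : Matrix.specialUnitaryGroup (Fin 2) ℂ) : Matrix (Fin 2) (Fin 2) ℂ) = 1 := by
      rw [← Submonoid.coe_mul, mul_inv_cancel, OneMemClass.coe_one]
    rw [Submonoid.coe_mul, Submonoid.coe_mul, hgcomm b, mul_assoc, hinv, mul_one]
  -- so `g = ±1`; a site with `T x ≠ 0` would give `g x` traceless — contradiction
  funext x
  by_contra hTx
  have hx : 0 < Complex.normSq (T x 0 0) + Complex.normSq (T x 0 1) := by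
    by_contra hx'; exact hTx (by rw [hTzero x hx', Pi.zero_apply])
  have htrg : Matrix.trace ((g x : Matrix.specialUnitaryGroup (Fin 2) ℂ) : Matrix (Fin 2) (Fin 2) ℂ) = 0 := by
    rw [hgval x hx, Matrix.trace_smul, htr x, smul_zero]
  rcases hstab g hgstab with h1 | h1
  · have : ((g x : Matrix.specialUnitaryGroup (Fin 2) ℂ) : Matrix (Fin 2) (Fin 2) ℂ) = 1 := by rw [h1]; rfl
    rw [this, Matrix.trace_one, Fintype.card_fin] at htrg
    norm_num at htrg
  · have : ((g x : Matrix.specialUnitaryGroup (Fin 2) ℂ) : Matrix (Fin 2) (Fin 2) ℂ) = -1 := by rw [h1]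
    rw [this, Matrix.trace_neg, Matrix.trace_one, Fintype.card_fin] at htrg
    norm_num at htrg

/-- ★★★ **THE BRIDGE: CENTRAL STABILISER ⟹ SCALAR COMMUTANT (IRR(V)).**  If every `SU(2)`-valued symmetry of the datum `V` is `±1` — ✓px17 pen 4
`atMostOneCriticalOrbit_of_centralStab_five`'s token VERBATIM — then every `s : sites → M₂(ℂ)` with `s(b₋)·V_b = V_b·s(b₊)` on all bonds is ONE scalar: `∃ c, ∀ x, s x = c·1`
(= the `hirr` binder of ✓∕⧗(T7a) `…S2BetaNearSymmetryRigidity.exists_near_scalar_of_irr` and of (T7b)).  Proof: split `s x = ½tr(s x)·1 + Y x`; the trace is constant along bonds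
(conjugation invariant); `Y + Yᴴ` and `i·(Y − Yᴴ)` are Hermitian traceless commutant elements, hence `0` (`hermTraceless_comm_eq_zero`); so `s x = α(x)·1` with `α` constant along
bonds, and `x ↦ ±1` according to `α x = α x₀` is a symmetry of `V`, hence `+1` everywhere: `α` is constant.
[cite: Balaban1985Variational, (4) p.278, Prop. 7 p.299; Balaban1985Averaging, (8) p.19] -/
theorem irr_of_centralStab (V : GaugeField (F.P J) 0 (Matrix.specialUnitaryGroup (Fin 2) ℂ))
    (hstab : ∀ s : GaugeTransf (F.P J) 0 (Matrix.specialUnitaryGroup (Fin 2) ℂ), GaugeField.gaugeAct s V = V →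
      s = (fun _ => 1) ∨ s = (fun _ => (⟨-1, neg_one_mem⟩ : Matrix.specialUnitaryGroup (Fin 2) ℂ))) :
    ∀ s : Site (F.P J) 0 → Matrix (Fin 2) (Fin 2) ℂ,
      (∀ b : PBond (F.P J) 0, s b.src * (V b : Matrix (Fin 2) (Fin 2) ℂ) = (V b : Matrix (Fin 2) (Fin 2) ℂ) * s b.tgt) →
        ∃ c : ℂ, ∀ x, s x = c • (1 : Matrix (Fin 2) (Fin 2) ℂ) := by
  classical
  intro s hs
  -- the trace is constant along bonds
  have htr : ∀ b : PBond (F.P J) 0, (s b.tgt).trace = (s b.src).trace := by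
    intro b
    rw [eq_conj_of_comm F V s b (hs b), Matrix.trace_mul_cycle, Matrix.mem_unitaryGroup_iff.1 (V b).2.1, one_mul]
  -- the traceless part `Y` and its Hermitian pieces
  obtain ⟨Y, hY⟩ : ∃ Y : Site (F.P J) 0 → Matrix (Fin 2) (Fin 2) ℂ, Y = fun x => s x - ((s x).trace / 2) • (1 : Matrix (Fin 2) (Fin 2) ℂ) := ⟨_, rfl⟩
  have hYcomm : ∀ b : PBond (F.P J) 0, Y b.src * (V b : Matrix (Fin 2) (Fin 2) ℂ) = (V b : Matrix (Fin 2) (Fin 2) ℂ) * Y b.tgt := by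
    intro b
    rw [hY]
    simp only [sub_mul, mul_sub, Matrix.smul_mul, Matrix.mul_smul, one_mul, mul_one, hs b, htr b]
  have hYtr : ∀ x, (Y x).trace = 0 := by
    intro x; rw [hY]; simp only [Matrix.trace_sub, Matrix.trace_smul, Matrix.trace_one, Fintype.card_fin, smul_eq_mul]; norm_num
  -- `H₁ := Y + Yᴴ`, `H₂ := i·(Y − Yᴴ)`
  have hH₁ : (fun x => Y x + (Y x)ᴴ) = 0 := by
    refine hermTraceless_comm_eq_zero F V hstab _ (fun b => ?_) (fun x => ?_) (fun x => ?_)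
    · rw [add_mul, mul_add, hYcomm b, comm_conjTranspose F V Y hYcomm b]
    · exact Matrix.isHermitian_add_transpose_self (Y x)
    · rw [Matrix.trace_add, Matrix.trace_conjTranspose, hYtr, star_zero, add_zero]
  have hH₂ : (fun x => Complex.I • (Y x - (Y x)ᴴ)) = 0 := by
    refine hermTraceless_comm_eq_zero F V hstab _ (fun b => ?_) (fun x => ?_) (fun x => ?_)
    · rw [Matrix.smul_mul, Matrix.mul_smul, sub_mul, mul_sub, hYcomm b, comm_conjTranspose F V Y hYcomm b]
    · -- `(i(Y − Yᴴ))ᴴ = −i(Yᴴ − Y) = i(Y − Yᴴ)`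
      show (Complex.I • (Y x - (Y x)ᴴ))ᴴ = Complex.I • (Y x - (Y x)ᴴ)
      rw [Matrix.conjTranspose_smul, Matrix.conjTranspose_sub, Matrix.conjTranspose_conjTranspose, Complex.star_def, Complex.conj_I,
        neg_smul, ← smul_neg, neg_sub]
    · rw [Matrix.trace_smul, Matrix.trace_sub, Matrix.trace_conjTranspose, hYtr, star_zero, sub_zero, smul_zero]
  have hY0 : ∀ x, Y x = 0 := by
    intro x
    have h1 : Y x + (Y x)ᴴ = 0 := congrFun hH₁ x
    have h2 : Complex.I • (Y x - (Y x)ᴴ) = 0 := congrFun hH₂ x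
    have h3 : Y x - (Y x)ᴴ = 0 := by
      rcases smul_eq_zero.mp h2 with h | h
      · exact absurd h Complex.I_ne_zero
      · exact h
    have : (2 : ℂ) • Y x = 0 := by
      rw [two_smul]
      calc Y x + Y x = (Y x + (Y x)ᴴ) + (Y x - (Y x)ᴴ) := by abel
        _ = 0 := by rw [h1, h3, add_zero]
    rcases smul_eq_zero.mp this with h | h
    · norm_num at h
    · exact h
  have hsα : ∀ x, s x = ((s x).trace / 2) • (1 : Matrix (Fin 2) (Fin 2) ℂ) := by
    intro x
    have := hY0 x
    rw [hY] at this
    exact sub_eq_zero.mp this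
  -- the scalar `α x := tr(s x)/2` is constant: test the symmetry `x ↦ ±1`
  obtain ⟨x₀⟩ : Nonempty (Site (F.P J) 0) := ⟨default⟩
  obtain ⟨g, hg⟩ : ∃ g : Site (F.P J) 0 → Matrix.specialUnitaryGroup (Fin 2) ℂ, g = fun x =>
      if (s x).trace = (s x₀).trace then 1 else (⟨-1, neg_one_mem⟩ : Matrix.specialUnitaryGroup (Fin 2) ℂ) := ⟨_, rfl⟩
  have hgb : ∀ b : PBond (F.P J) 0, g b.src = g b.tgt := by
    intro b; rw [hg]; simp only [htr b]
  have hcentral : ∀ x (A : Matrix.specialUnitaryGroup (Fin 2) ℂ), g x * A * (g x)⁻¹ = A := by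
    intro x A
    rw [hg]
    by_cases h : (s x).trace = (s x₀).trace
    · simp only [if_pos h, one_mul, inv_one, mul_one]
    · simp only [if_neg h]
      have hc := Summit.QuantumFields.YangMills.Theorems.FluctuationComparisonRegPrIntLS2BetaCriticalOrbitUnique.negOne_mul_comm A
      rw [hc, mul_inv_cancel_right]
  have hgstab : GaugeField.gaugeAct g V = V := by
    funext b
    show g b.src * V b * (g b.tgt)⁻¹ = V b
    rw [← hgb b]; exact hcentral _ _
  have hone : g = fun _ => 1 := by
    rcases hstab g hgstab with h | h
    · exact h
    · exfalso
      have hx₀ : g x₀ = 1 := by rw [hg]; simp only [if_true]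
      have : (1 : Matrix.specialUnitaryGroup (Fin 2) ℂ) = ⟨-1, neg_one_mem⟩ := by rw [← hx₀, h]
      have h00 := congrArg (fun A : Matrix.specialUnitaryGroup (Fin 2) ℂ => (A : Matrix (Fin 2) (Fin 2) ℂ) 0 0) this
      norm_num at h00
  refine ⟨(s x₀).trace / 2, fun x => ?_⟩
  have hx : (s x).trace = (s x₀).trace := by
    by_contra hne
    have : g x = ⟨-1, neg_one_mem⟩ := by rw [hg]; simp only [if_neg hne]
    rw [hone] at this
    have h00 := congrArg (fun A : Matrix.specialUnitaryGroup (Fin 2) ℂ => (A : Matrix (Fin 2) (Fin 2) ℂ) 0 0) this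
    norm_num at h00
  rw [hsα x, hx]

end Bridge

end Summit.QuantumFields.YangMills.Theorems.FluctuationComparisonRegPrIntLS2BetaIrrOfCentralStab

end
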